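import Summits.ResolutionOfSingularities.ResolutionOfSingularities.Theorems.FrobeniusClosingSteerBetaPolygonGauge
import Mathlib.Algebra.Ring.GeomSum
import HarnessLib

/-!
# Crux `Steer` (stmt-ResolutionOfSingularities-16345), chain W4.1 — hK4′ β-leaf words: MONOTONICITIES, LABEL INDEPENDENCE (G2),
# idle cleanings, and the SHEAR `y ↦ y − c·x` (G3) for the threshold predicates `α ≥ ρ`, `δ ≥ ρ`, `β ≥ ρ`

OURS (campaign `res-hironaka`, rung L ★L-G4, slot W4.1; seat res-L0-w41-stub-4 g7, K-β1♭ gauge side per res-L0-w41-plan-1 RULINGS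
142b / 143 / 147b; owner res-L0-w41-stub-1 g4); replaces the role of no printed item; NOT a statement of the manuscript under review
[claim: Hironaka2017, status: under-review]; AI-produced, weaker than expert review. Theses-free and definition-free over the TREE words
`AlphaGe` / `DeltaGe` / `BetaGe` (`…FrobeniusClosingSteerBetaPolygonWords`, p536143; companions of its `alphaGe_anti`).

* `deltaGe_anti` — `δ ≥ ρ` is antitone in `ρ` (companion of the tree's `alphaGe_anti` and of res-L0-w41-stub-1's
  `BetaPolygon.betaGe_anti` in `…BetaPolygonRounding`, p538626).
* `deltaGe_of_alphaGe` — `α ≥ ρ ⇒ δ ≥ ρ` (`(x^c) ≤ (x, y)^c`), i.e. `δ ≥ α`.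
* (G2) LABEL INDEPENDENCE `alphaGe_swap` / `deltaGe_swap` / `betaGe_swap` — the predicates do not depend on the order of the two
  directrix variables `z, w` (re-indexing `(i, j) ↦ (j, i)`); representative-independence of the star values is definitional.
* closure under `+` / scalars (`AlphaGe.add`, `.mul_left`, …) and IDLE CLEANINGS `alphaGe_add_iff_of_alphaGe` / `deltaGe_…` / `betaGe_…`
  (adding a member of the threshold ideal — e.g. a square `q²` at or right-above the vertex — changes nothing; G1, cleaning half).
* (G3) SHEAR `betaGe_shear_iff` (= idea-1 v15/v17 §5 support statement `BetaGeShearInvariant`, proved for ALL `α, ρ` with no sign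
  hypotheses — `betaGeShearInvariant` is its verbatim `∀`-form; CJS Lemma 13.6) and `deltaGe_shear_iff` (`(x, y − c x) = (x, y)`);
  `AlphaGe` does not mention `y`; the gauge orbit and the star values (plain and TWISTED, res-L0-w41-stub-1's `…BetaPolygonGauge`
  §2/§2♭) are shear-invariant: `isGaugeRep(Tw)_shear_iff`, `alphaStarGeTw_/deltaStarGeTw_/isDeltaStarTw_/isVStarTw_shear_iff`,
  `isVStar_shear_iff`, `betaGt_shear_iff`.

[cite: CossartJannsenSaito2020, Def. 11.1, (11.1), Lemma 13.6] [folklore]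
bears_on: LADDER-RESOLUTION L ★L-G4 W4.1 (crux `Steer`, binder hK4′, debt K-β1♭).
-/

noncomputable section

-- `Summit.<S>.<S>.…` duplicates the summit name by design (single-problem summit).
set_option linter.dupNamespace false

open IsLocalRing

namespace Summit.ResolutionOfSingularities.ResolutionOfSingularities.Theorems.SwitchingDichotomy.BetaPolygonMoves

open Summit.ResolutionOfSingularities.ResolutionOfSingularities.Theorems.SwitchingDichotomy.BetaPolygon

variable {S : Type} [CommRing S]

/-! ## §5 Small monotonicities -/

/-- `δ ≥ ρ' ⇒ δ ≥ ρ` for `ρ ≤ ρ'`. OURS. [folklore] -/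
theorem deltaGe_anti {x y z w : S} {d : ℕ} {ρ ρ' : ℚ} (h : ρ ≤ ρ') {f : S} (hf : DeltaGe x y z w d ρ' f) :
    DeltaGe x y z w d ρ f := by
  unfold DeltaGe at hf ⊢
  have key : ∀ i j : ℕ,
      Ideal.span ({x, y} : Set S) ^ ⌈ρ' * ((d - i - j : ℕ) : ℚ)⌉₊ * Ideal.span {z ^ i * w ^ j} ≤
        Ideal.span {x, y} ^ ⌈ρ * ((d - i - j : ℕ) : ℚ)⌉₊ * Ideal.span {z ^ i * w ^ j} := fun i j =>
    Ideal.mul_mono_left (Ideal.pow_le_pow_right (Nat.ceil_mono (mul_le_mul_of_nonneg_right h (by positivity))))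
  exact SetLike.le_def.mp (sup_le_sup_left (iSup_mono fun i => iSup_mono fun j => iSup_mono fun _ => key i j) _) hf

/-- `α ≥ ρ ⇒ δ ≥ ρ` (`(x^c) ≤ (x, y)^c`: the polygon lies right of its left vertex, `δ ≥ α`). OURS. [folklore] -/
theorem deltaGe_of_alphaGe {x y z w : S} {d : ℕ} {ρ : ℚ} {f : S} (hf : AlphaGe x z w d ρ f) :
    DeltaGe x y z w d ρ f := by
  unfold AlphaGe at hf
  unfold DeltaGe
  have key : ∀ i j : ℕ,
      Ideal.span ({x ^ ⌈ρ * ((d - i - j : ℕ) : ℚ)⌉₊ * z ^ i * w ^ j} : Set S) ≤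
        Ideal.span {x, y} ^ ⌈ρ * ((d - i - j : ℕ) : ℚ)⌉₊ * Ideal.span {z ^ i * w ^ j} := fun i j => by
    rw [Ideal.span_singleton_le_iff_mem, mul_assoc]
    exact Ideal.mul_mem_mul (Ideal.pow_mem_pow (Ideal.subset_span (by simp)) _) (Ideal.mem_span_singleton_self _)
  exact SetLike.le_def.mp (sup_le_sup_left (iSup_mono fun i => iSup_mono fun j => iSup_mono fun _ => key i j) _) hf



/-! ## Label independence (G2): the swap `z ↔ w` -/

/-- Re-indexing `(i, j) ↦ (j, i)` under the constraint `i + j < d`. -/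
theorem iSup_swap_index (T : ℕ → ℕ → Ideal S) (d : ℕ) :
    (⨆ (i : ℕ) (j : ℕ) (_ : i + j < d), T i j) = ⨆ (i : ℕ) (j : ℕ) (_ : i + j < d), T j i :=
  le_antisymm
    (iSup_le fun i => iSup_le fun j => iSup_le fun h =>
      le_iSup_of_le j (le_iSup_of_le i (le_iSup_of_le (by omega) le_rfl)))
    (iSup_le fun i => iSup_le fun j => iSup_le fun h =>
      le_iSup_of_le j (le_iSup_of_le i (le_iSup_of_le (by omega) le_rfl)))

/-- **(G2) `α` does not depend on the order of the directrix variables**: `AlphaGe x z w … ↔ AlphaGe x w z …`. OURS. [folklore] -/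
theorem alphaGe_swap (x z w : S) (d : ℕ) (ρ : ℚ) (f : S) : AlphaGe x z w d ρ f ↔ AlphaGe x w z d ρ f := by
  unfold AlphaGe
  rw [Ideal.span_pair_comm, iSup_swap_index (fun i j => Ideal.span {x ^ ⌈ρ * ((d - i - j : ℕ) : ℚ)⌉₊ * w ^ i * z ^ j}) d]
  have key : ∀ i j : ℕ, Ideal.span ({x ^ ⌈ρ * ((d - j - i : ℕ) : ℚ)⌉₊ * w ^ j * z ^ i} : Set S) =
      Ideal.span {x ^ ⌈ρ * ((d - i - j : ℕ) : ℚ)⌉₊ * z ^ i * w ^ j} := fun i j => by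
    rw [show d - j - i = d - i - j by omega, mul_right_comm]
  simp_rw [key]

/-- **(G2)** `DeltaGe x y z w … ↔ DeltaGe x y w z …`. OURS. [folklore] -/
theorem deltaGe_swap (x y z w : S) (d : ℕ) (ρ : ℚ) (f : S) : DeltaGe x y z w d ρ f ↔ DeltaGe x y w z d ρ f := by
  unfold DeltaGe
  rw [Ideal.span_pair_comm (x := z),
    iSup_swap_index (fun i j => Ideal.span {x, y} ^ ⌈ρ * ((d - i - j : ℕ) : ℚ)⌉₊ * Ideal.span {w ^ i * z ^ j}) d]
  have key : ∀ i j : ℕ, Ideal.span ({x, y} : Set S) ^ ⌈ρ * ((d - j - i : ℕ) : ℚ)⌉₊ * Ideal.span {w ^ j * z ^ i} =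
      Ideal.span {x, y} ^ ⌈ρ * ((d - i - j : ℕ) : ℚ)⌉₊ * Ideal.span {z ^ i * w ^ j} := fun i j => by
    rw [show d - j - i = d - i - j by omega, mul_comm (w ^ j)]
  simp_rw [key]

/-- **(G2)** `BetaGe x y z w … ↔ BetaGe x y w z …`. OURS. [folklore] -/
theorem betaGe_swap (x y z w : S) (d : ℕ) (α ρ : ℚ) (f : S) :
    BetaGe x y z w d α ρ f ↔ BetaGe x y w z d α ρ f := by
  unfold BetaGe
  rw [Ideal.span_pair_comm (x := z),
    iSup_swap_index (fun i j => Ideal.span {x ^ (⌊α * ((d - i - j : ℕ) : ℚ)⌋₊ + 1) * w ^ i * z ^ j} ⊔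
      Ideal.span {x ^ ⌈α * ((d - i - j : ℕ) : ℚ)⌉₊ * y ^ ⌈ρ * ((d - i - j : ℕ) : ℚ)⌉₊ * w ^ i * z ^ j}) d]
  have key : ∀ i j : ℕ,
      Ideal.span {x ^ (⌊α * ((d - j - i : ℕ) : ℚ)⌋₊ + 1) * w ^ j * z ^ i} ⊔
          Ideal.span ({x ^ ⌈α * ((d - j - i : ℕ) : ℚ)⌉₊ * y ^ ⌈ρ * ((d - j - i : ℕ) : ℚ)⌉₊ * w ^ j * z ^ i} : Set S) =
        Ideal.span {x ^ (⌊α * ((d - i - j : ℕ) : ℚ)⌋₊ + 1) * z ^ i * w ^ j} ⊔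
          Ideal.span {x ^ ⌈α * ((d - i - j : ℕ) : ℚ)⌉₊ * y ^ ⌈ρ * ((d - i - j : ℕ) : ℚ)⌉₊ * z ^ i * w ^ j} := fun i j => by
    rw [show d - j - i = d - i - j by omega, mul_right_comm (x ^ _), mul_right_comm (x ^ _ * y ^ _)]
  simp_rw [key]

/-! ## The threshold predicates are ideal memberships: closure under `+`, scalars, and cleaning by members -/

/-- `AlphaGe` is closed under addition. -/
theorem AlphaGe.add {x z w : S} {d : ℕ} {ρ : ℚ} {f g : S} (hf : AlphaGe x z w d ρ f) (hg : AlphaGe x z w d ρ g) :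
    AlphaGe x z w d ρ (f + g) := Ideal.add_mem _ hf hg

/-- `AlphaGe` is closed under scalar multiplication. -/
theorem AlphaGe.mul_left {x z w : S} {d : ℕ} {ρ : ℚ} {f : S} (c : S) (hf : AlphaGe x z w d ρ f) :
    AlphaGe x z w d ρ (c * f) := Ideal.mul_mem_left _ c hf

/-- Cleaning by a member does not change `α ≥ ρ`: if `s` itself satisfies the threshold then `f + s` does iff `f` does
(G1, «only squares at / left of the vertex matter»: a square `q²` inside the threshold ideal is an idle cleaning). -/
theorem alphaGe_add_iff_of_alphaGe {x z w : S} {d : ℕ} {ρ : ℚ} {f s : S} (hs : AlphaGe x z w d ρ s) :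
    AlphaGe x z w d ρ (f + s) ↔ AlphaGe x z w d ρ f :=
  ⟨fun h => by have h' := Ideal.sub_mem _ h hs; rwa [add_sub_cancel_right] at h', fun h => Ideal.add_mem _ h hs⟩

/-- `DeltaGe` is closed under addition. -/
theorem DeltaGe.add {x y z w : S} {d : ℕ} {ρ : ℚ} {f g : S} (hf : DeltaGe x y z w d ρ f) (hg : DeltaGe x y z w d ρ g) :
    DeltaGe x y z w d ρ (f + g) := Ideal.add_mem _ hf hg

/-- `DeltaGe` is closed under scalar multiplication. -/
theorem DeltaGe.mul_left {x y z w : S} {d : ℕ} {ρ : ℚ} {f : S} (c : S) (hf : DeltaGe x y z w d ρ f) :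
    DeltaGe x y z w d ρ (c * f) := Ideal.mul_mem_left _ c hf

/-- Cleaning by a member does not change `δ ≥ ρ`. -/
theorem deltaGe_add_iff_of_deltaGe {x y z w : S} {d : ℕ} {ρ : ℚ} {f s : S} (hs : DeltaGe x y z w d ρ s) :
    DeltaGe x y z w d ρ (f + s) ↔ DeltaGe x y z w d ρ f :=
  ⟨fun h => by have h' := Ideal.sub_mem _ h hs; rwa [add_sub_cancel_right] at h', fun h => Ideal.add_mem _ h hs⟩

/-- `BetaGe` is closed under addition. -/
theorem BetaGe.add {x y z w : S} {d : ℕ} {α ρ : ℚ} {f g : S} (hf : BetaGe x y z w d α ρ f)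
    (hg : BetaGe x y z w d α ρ g) : BetaGe x y z w d α ρ (f + g) := Ideal.add_mem _ hf hg

/-- `BetaGe` is closed under scalar multiplication. -/
theorem BetaGe.mul_left {x y z w : S} {d : ℕ} {α ρ : ℚ} {f : S} (c : S) (hf : BetaGe x y z w d α ρ f) :
    BetaGe x y z w d α ρ (c * f) := Ideal.mul_mem_left _ c hf

/-- Cleaning by a member does not change `β ≥ ρ`. -/
theorem betaGe_add_iff_of_betaGe {x y z w : S} {d : ℕ} {α ρ : ℚ} {f s : S} (hs : BetaGe x y z w d α ρ s) :
    BetaGe x y z w d α ρ (f + s) ↔ BetaGe x y z w d α ρ f :=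
  ⟨fun h => by have h' := Ideal.sub_mem _ h hs; rwa [add_sub_cancel_right] at h', fun h => Ideal.add_mem _ h hs⟩

/-! ## (G3) The shear `y ↦ y − c·x` (CJS Lemma 13.6 «the column `a = α` keeps its initial forms», in ideal form) -/

/-- `y ^ b − (y − c·x) ^ b ∈ (x)`: the shear moves a power of `y` by a multiple of `x`. -/
theorem pow_sub_shear_pow_mem_span (x y c : S) (b : ℕ) : y ^ b - (y - c * x) ^ b ∈ Ideal.span {x} := by
  have h : y - (y - c * x) ∣ y ^ b - (y - c * x) ^ b := sub_dvd_pow_sub_pow y (y - c * x) b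
  rw [show y - (y - c * x) = c * x by ring] at h
  exact Ideal.mem_span_singleton.mpr (dvd_trans (Dvd.intro_left c rfl) h)

/-- One column cell of the `β`-threshold ideal is shear-invariant: with `a ≤ a'`,
`(x^(a+1)·m, x^a'·(y − c x)^b·m) ≤ (x^(a+1)·m, x^a'·y^b·m)`. -/
theorem span_cell_shear_le (x y c m : S) {a a' : ℕ} (ha : a ≤ a') (b : ℕ) :
    Ideal.span {x ^ (a + 1) * m} ⊔ Ideal.span {x ^ a' * (y - c * x) ^ b * m} ≤
      Ideal.span {x ^ (a + 1) * m} ⊔ Ideal.span {x ^ a' * y ^ b * m} := by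
  refine sup_le le_sup_left ?_
  rw [Ideal.span_singleton_le_iff_mem]
  obtain ⟨k, rfl⟩ := Nat.exists_eq_add_of_le ha
  obtain ⟨r, hr⟩ := Ideal.mem_span_singleton'.mp (pow_sub_shear_pow_mem_span x y c b)
  -- `x^a' (y - c x)^b m = x^a' y^b m - x^(a'+1) r m`
  rw [show x ^ (a + k) * (y - c * x) ^ b * m
      = x ^ (a + k) * y ^ b * m - x ^ (a + k) * (y ^ b - (y - c * x) ^ b) * m by ring, ← hr,
    show x ^ (a + k) * (r * x) * m = (x ^ k * r) * (x ^ (a + 1) * m) by ring]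
  exact Ideal.sub_mem _ (Ideal.mem_sup_right (Ideal.mem_span_singleton_self _))
    (Ideal.mem_sup_left (Ideal.mul_mem_left _ _ (Ideal.mem_span_singleton_self _)))

/-- The column cell is shear-INVARIANT (apply `span_cell_shear_le` to `c` and to `−c`). -/
theorem span_cell_shear_eq (x y c m : S) {a a' : ℕ} (ha : a ≤ a') (b : ℕ) :
    Ideal.span {x ^ (a + 1) * m} ⊔ Ideal.span {x ^ a' * (y - c * x) ^ b * m} =
      Ideal.span {x ^ (a + 1) * m} ⊔ Ideal.span {x ^ a' * y ^ b * m} := by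
  refine le_antisymm (span_cell_shear_le x y c m ha b) ?_
  have := span_cell_shear_le x (y - c * x) (-c) m ha b
  rwa [show y - c * x - -c * x = y by ring] at this

/-- **`BetaGeShearInvariant`** (idea-1 v15/v17 §5 support statement; CJS Lemma 13.6 «the column `a = α` keeps its initial
forms» in ideal form): the `β`-threshold predicate is invariant under the shear `y ↦ y − c·x` — for EVERY `α, ρ : ℚ`
(no sign hypotheses needed: `⌊t⌋₊ ≤ ⌈t⌉₊` always). OURS. [folklore] -/
theorem betaGe_shear_iff (x y z w c : S) (d : ℕ) (α ρ : ℚ) (f : S) :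
    BetaGe x y z w d α ρ f ↔ BetaGe x (y - c * x) z w d α ρ f := by
  unfold BetaGe
  have key : ∀ i j : ℕ,
      Ideal.span {x ^ (⌊α * ((d - i - j : ℕ) : ℚ)⌋₊ + 1) * z ^ i * w ^ j} ⊔
          Ideal.span {x ^ ⌈α * ((d - i - j : ℕ) : ℚ)⌉₊ * (y - c * x) ^ ⌈ρ * ((d - i - j : ℕ) : ℚ)⌉₊ * z ^ i * w ^ j} =
        Ideal.span {x ^ (⌊α * ((d - i - j : ℕ) : ℚ)⌋₊ + 1) * z ^ i * w ^ j} ⊔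
          Ideal.span ({x ^ ⌈α * ((d - i - j : ℕ) : ℚ)⌉₊ * y ^ ⌈ρ * ((d - i - j : ℕ) : ℚ)⌉₊ * z ^ i * w ^ j} : Set S) := by
    intro i j
    have h := span_cell_shear_eq x y c (z ^ i * w ^ j) (Nat.floor_le_ceil (α * ((d - i - j : ℕ) : ℚ)))
      ⌈ρ * ((d - i - j : ℕ) : ℚ)⌉₊
    simpa only [mul_assoc] using h
  simp_rw [key]

/-- The verbatim support statement of idea-1 v15/v17 §5 (`BetaGeShearInvariant`), as a theorem. OURS. [folklore] -/
theorem betaGeShearInvariant :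
    ∀ (S : Type) [CommRing S] (x y z w : S) (c : S) (d : ℕ) (α ρ : ℚ) (f : S), 0 ≤ α → 0 ≤ ρ →
      (BetaGe x y z w d α ρ f ↔ BetaGe x (y - c * x) z w d α ρ f) :=
  fun _ _ x y z w c d α ρ f _ _ => betaGe_shear_iff x y z w c d α ρ f

/-- The `δ`-threshold predicate is shear-invariant (`(x, y − c x) = (x, y)`). OURS. [folklore] -/
theorem deltaGe_shear_iff (x y z w c : S) (d : ℕ) (ρ : ℚ) (f : S) :
    DeltaGe x y z w d ρ f ↔ DeltaGe x (y - c * x) z w d ρ f := by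
  unfold DeltaGe
  rw [Ideal.span_pair_sub_mul_left]


/-- Twisted gauge representatives are the same before and after the shear (`(x, y − c x) = (x, y)`). OURS. [folklore] -/
theorem isGaugeRepTw_shear_iff (u x y z w c f z' w' f' : S) :
    IsGaugeRepTw u x y z w f z' w' f' ↔ IsGaugeRepTw u x (y - c * x) z w f z' w' f' := by
  unfold IsGaugeRepTw
  rw [Ideal.span_pair_sub_mul_left]

/-- Plain gauge representatives are shear-invariant. OURS. [folklore] -/
theorem isGaugeRep_shear_iff (x y z w c f z' w' f' : S) :
    IsGaugeRep x y z w f z' w' f' ↔ IsGaugeRep x (y - c * x) z w f z' w' f' := by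
  unfold IsGaugeRep
  rw [Ideal.span_pair_sub_mul_left]

/-- The twisted star value `α*` is shear-invariant. OURS. [folklore] -/
theorem alphaStarGeTw_shear_iff (u x y z w c : S) (d : ℕ) (ρ : ℚ) (f : S) :
    AlphaStarGeTw u x y z w d ρ f ↔ AlphaStarGeTw u x (y - c * x) z w d ρ f := by
  unfold AlphaStarGeTw
  simp_rw [← isGaugeRepTw_shear_iff]

/-- The twisted star value `δ*` is shear-invariant. OURS. [folklore] -/
theorem deltaStarGeTw_shear_iff (u x y z w c : S) (d : ℕ) (ρ : ℚ) (f : S) :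
    DeltaStarGeTw u x y z w d ρ f ↔ DeltaStarGeTw u x (y - c * x) z w d ρ f := by
  unfold DeltaStarGeTw
  simp_rw [← isGaugeRepTw_shear_iff, ← deltaGe_shear_iff]

/-- `IsDeltaStarTw` is shear-invariant. OURS. [folklore] -/
theorem isDeltaStarTw_shear_iff (u x y z w c : S) (d : ℕ) (δ : ℚ) (f : S) :
    IsDeltaStarTw u x y z w d δ f ↔ IsDeltaStarTw u x (y - c * x) z w d δ f := by
  unfold IsDeltaStarTw
  simp_rw [← deltaStarGeTw_shear_iff]

/-- **The twisted left vertex `v* = (α*, β*)` is shear-invariant** (CJS Lemma 13.6 for the β-line's gauge: the shear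
`y ↦ y − λx` before a `(1:λ)`-letter changes no star value). OURS. [folklore] -/
theorem isVStarTw_shear_iff (u x y z w c : S) (d : ℕ) (α β : ℚ) (f : S) :
    IsVStarTw u x y z w d α β f ↔ IsVStarTw u x (y - c * x) z w d α β f := by
  unfold IsVStarTw
  simp_rw [← isGaugeRepTw_shear_iff, ← betaGe_shear_iff]

/-- The plain left vertex `v*` is shear-invariant. OURS. [folklore] -/
theorem isVStar_shear_iff (x y z w c : S) (d : ℕ) (α β : ℚ) (f : S) :
    IsVStar x y z w d α β f ↔ IsVStar x (y - c * x) z w d α β f := by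
  unfold IsVStar
  simp_rw [← isGaugeRep_shear_iff, ← betaGe_shear_iff]

/-- `BetaGt` is shear-invariant (same column cells with `⌊βn⌋ + 1` in place of `⌈ρn⌉`). OURS. [folklore] -/
theorem betaGt_shear_iff (x y z w c : S) (d : ℕ) (α β : ℚ) (f : S) :
    BetaGt x y z w d α β f ↔ BetaGt x (y - c * x) z w d α β f := by
  unfold BetaGt
  have key : ∀ i j : ℕ,
      Ideal.span {x ^ (⌊α * ((d - i - j : ℕ) : ℚ)⌋₊ + 1) * z ^ i * w ^ j} ⊔
          Ideal.span {x ^ ⌈α * ((d - i - j : ℕ) : ℚ)⌉₊ * (y - c * x) ^ (⌊β * ((d - i - j : ℕ) : ℚ)⌋₊ + 1) * z ^ i * w ^ j} =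
        Ideal.span {x ^ (⌊α * ((d - i - j : ℕ) : ℚ)⌋₊ + 1) * z ^ i * w ^ j} ⊔
          Ideal.span ({x ^ ⌈α * ((d - i - j : ℕ) : ℚ)⌉₊ * y ^ (⌊β * ((d - i - j : ℕ) : ℚ)⌋₊ + 1) * z ^ i * w ^ j} : Set S) := by
    intro i j
    have h := span_cell_shear_eq x y c (z ^ i * w ^ j) (Nat.floor_le_ceil (α * ((d - i - j : ℕ) : ℚ)))
      (⌊β * ((d - i - j : ℕ) : ℚ)⌋₊ + 1)
    simpa only [mul_assoc] using h
  simp_rw [key]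

end Summit.ResolutionOfSingularities.ResolutionOfSingularities.Theorems.SwitchingDichotomy.BetaPolygonMoves

end
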